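/-
Support file for the crux idea `wild-twist-at-cm-prime` (REV 5) on
`Summit.BirchSwinnertonDyer.BirchSwinnertonDyer.Theses.SylvesterTwoHeegnerIndex.UpperOffV0HSYPlus`
(stmt-BirchSwinnertonDyer-19804).  Mathlib only; NOT a skeleton line (no `stub_*`, no `_of`).

THE PROJECTOR LEMMA (algebraic core of P5 = former crux K2, "𝔮-stringency of the derivative
classes").  Arithmetic reading: `P = A(H_w)` (points of the Gross-curve twist over the completed
ring-class layer at the CM prime), `Φ` = Néron component group of the I₀*-fibre over the odd layer
`L′`, `c = c_w` the component map, `I = Gal(H_{q^k n}/H_n) ≅ ℤ/q^k` = inertia at 𝔮 acting on `P`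
and — because it fixes the three `K_𝔮`-rational 2-torsion sections marking the components —
TRIVIALLY on `Φ` (`hc`), `χ` the faithful order-`q^k` ring-class character (so `∑ g, χ g = 0`).
Conclusion: `c ⊗ 1` kills every χ-projector image `e_χ x = ∑ g, g•x ⊗ χ g`; applied to
`x = X′ = (F̃ − 1) D_n y_n / 2^M` this is `loc_𝔮 d^χ(n) = 0` (Kummer condition at the wild prime),
applied to `x = D_n y_n` it is `P^χ(n) ∈ A⁰(H_w) ⊗ R₀` (Jetchev-stringent over `L′`).
-/
import Mathlib

namespace Summit.BirchSwinnertonDyer.BirchSwinnertonDyer.Cruxes.UpperOffV0HSYPlus.WildTwistAtCMPrime.ProjectorLemma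

open scoped TensorProduct

/-- PROJECTOR LEMMA, abstract form: an `I`-invariant additive map `c : P →+ Φ`, tensored with the
identity of the coefficient ring `R`, kills the `χ`-projector image `∑ g, (g • x) ⊗ χ g` of every
`x : P` as soon as the character sum `∑ g, χ g` vanishes. -/
theorem map_projector_eq_zero {I P Φ R : Type*} [Group I] [Fintype I]
    [AddCommGroup P] [AddCommGroup Φ] [CommRing R] [DistribMulAction I P]
    (c : P →+ Φ) (hc : ∀ (g : I) (x : P), c (g • x) = c x)
    (χ : I → R) (hχ : ∑ g, χ g = 0) (x : P) :
    TensorProduct.map c.toIntLinearMap (LinearMap.id : R →ₗ[ℤ] R)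
      (∑ g : I, (g • x) ⊗ₜ[ℤ] χ g) = 0 := by
  simp only [map_sum, TensorProduct.map_tmul, AddMonoidHom.coe_toIntLinearMap, hc,
    LinearMap.id_coe, id_eq]
  rw [← TensorProduct.tmul_sum, hχ, TensorProduct.tmul_zero]

/-- The character-sum hypothesis: a non-trivial multiplicative character of a finite group into an
integral domain sums to zero (Mathlib `sum_hom_units_eq_zero`).  For `I ≅ ℤ/q^k` and `χ = χ₀^{∓1}`,
`χ₀²` faithful of order `q^k > 1` this is `1 + ζ + ⋯ + ζ^{q^k-1} = 0`. -/
theorem charSum_eq_zero {I R : Type*} [Group I] [Fintype I] [CommRing R] [IsDomain R]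
    (χ : I →* R) (hχ : χ ≠ 1) : ∑ g, χ g = 0 :=
  sum_hom_units_eq_zero χ hχ

/-- PROJECTOR LEMMA for a non-trivial multiplicative character (the form used in P5 (5)):
`(c_w ⊗ 1)(e_χ x) = 0` for every `x ∈ A(H_w)`. -/
theorem map_projector_eq_zero_of_ne_one {I P Φ R : Type*} [Group I] [Fintype I]
    [AddCommGroup P] [AddCommGroup Φ] [CommRing R] [IsDomain R] [DistribMulAction I P]
    (c : P →+ Φ) (hc : ∀ (g : I) (x : P), c (g • x) = c x)
    (χ : I →* R) (hχ : χ ≠ 1) (x : P) :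
    TensorProduct.map c.toIntLinearMap (LinearMap.id : R →ₗ[ℤ] R)
      (∑ g : I, (g • x) ⊗ₜ[ℤ] χ g) = 0 :=
  map_projector_eq_zero c hc χ (charSum_eq_zero χ hχ) x

/-- Kernel form: the χ-projector image lies in the kernel of `c ⊗ 1`; with `R` free over `ℤ`
(e.g. `R = ℤ[ζ_{q^k}]`) that kernel is `ker c ⊗ R = A⁰(H_w) ⊗ R`, i.e. `P^χ(n) ∈ A⁰(H_w) ⊗ R`. -/
theorem projector_mem_ker {I P Φ R : Type*} [Group I] [Fintype I]
    [AddCommGroup P] [AddCommGroup Φ] [CommRing R] [IsDomain R] [DistribMulAction I P]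
    (c : P →+ Φ) (hc : ∀ (g : I) (x : P), c (g • x) = c x)
    (χ : I →* R) (hχ : χ ≠ 1) (x : P) :
    (∑ g : I, (g • x) ⊗ₜ[ℤ] χ g) ∈
      LinearMap.ker (TensorProduct.map c.toIntLinearMap (LinearMap.id : R →ₗ[ℤ] R)) :=
  map_projector_eq_zero_of_ne_one c hc χ hχ x

/-- Invariance transport used in P5 (4): if `I` acts on `Φ` through automorphisms `γ` with
`c (g • x) = γ g (c x)` (equivariance of the component map) and every `γ g` is the identity
(inertia fixes the 2-torsion sections marking the components), then `c` is `I`-invariant. -/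
theorem invariant_of_equivariant_trivial {I P Φ : Type*} [Group I]
    [AddCommGroup P] [AddCommGroup Φ] [DistribMulAction I P]
    (c : P →+ Φ) (γ : I → Φ →+ Φ) (hequiv : ∀ (g : I) (x : P), c (g • x) = γ g (c x))
    (htriv : ∀ g, γ g = AddMonoidHom.id Φ) : ∀ (g : I) (x : P), c (g • x) = c x := by
  intro g x
  rw [hequiv, htriv]
  rfl

/-- Marking argument of P5 (4), abstractly: an endomorphism `γ` of a group `Φ` that fixes a
generating family pointwise is the identity on the subgroup it generates — here `Φ ≅ (ℤ/2)²` is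
generated by the images of the three rational 2-torsion points, each fixed by inertia. -/
theorem endo_eq_id_of_fix_closure {Φ : Type*} [AddCommGroup Φ] (γ : Φ →+ Φ) (S : Set Φ)
    (hfix : ∀ s ∈ S, γ s = s) (hgen : AddSubgroup.closure S = ⊤) : γ = AddMonoidHom.id Φ := by
  ext x
  have hx : x ∈ AddSubgroup.closure S := by rw [hgen]; exact AddSubgroup.mem_top x
  induction hx using AddSubgroup.closure_induction with
  | mem s hs => simpa using hfix s hs
  | zero => simp
  | add a b _ _ ha hb => simp only [map_add, AddMonoidHom.id_apply] at ha hb ⊢; rw [ha, hb]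
  | neg a _ ha => simp only [map_neg, AddMonoidHom.id_apply] at ha ⊢; rw [ha]

end Summit.BirchSwinnertonDyer.BirchSwinnertonDyer.Cruxes.UpperOffV0HSYPlus.WildTwistAtCMPrime.ProjectorLemma
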